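import Summits.HodgeConjecture.HodgeConjecture.Theorems.MarkmanPartnerTransportPicardThreeK3SquaresIsogenyDatum
import Summits.HodgeConjecture.HodgeConjecture.Theorems.MarkmanPartnerTransportFiniteMorphismGeometricGenus
import Literature.AlgebraicGeometry.HodgeTheory.ComplexOrientationDegreeOne

/-!
# Route MarkmanPartnerTransport · crux `PicardThreeK3Squares` (stmt-HodgeConjecture-19652) —
# programme «ISOGENY DATUM», brick 8: the roof of a RESOLVED RATIONAL MAP — birational leg read
# geometrically (`Resolution.IsBirational`), the Hodge-theoretic roof hypotheses discharged

The capstone `…PicardThreeK3SquaresIsogenyDatum.cycleInduced_of_roof'` asks, for the roof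
`Y ←π— Z —f→ X`, the cohomological degrees `π₊ 1 = d • 1`, `f₊ 1 = n • 1` and `HasGeometricGenusOne Z`.
When `π` is a BIRATIONAL MORPHISM (Mathlib/tree `Resolution.IsBirational π.left`; e.g. the blow-up
resolving the indeterminacy of a dominant rational map `Y ⇢ X`), all hypotheses on the `π`-leg are
theorems of the tree: `π₊ 1 = 1` (Fulton's Lemma 19.1.2 with degree one,
`complexGysin_complexOrientationFamily_one_of_isBirational`), hence `π^*` injective (brick 1) and
`p_g(Z) = p_g(Y) = 1` (brick 7, Hartshorne II 8.19). What remains is the degree `n` of `f` (a finite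
fibre of `n` local-homeomorphism points, `FiniteMorphism.gysin_one_eq_of_finite_fibre`).

* `deg_one_of_isBirational` — `Deg[π, 1]` for a birational morphism of smooth projective surfaces;
* `hasGeometricGenusOne_of_isBirational_of_isK3Surface` — the blow-up of a K3 surface has `p_g = 1`;
* **`cycleInduced_of_resolvedRationalMap`** — for marked projective K3 surfaces `X`, `Y`, a birational
  morphism `π : Z ⟶ Y` from a smooth projective surface and a morphism `f : Z ⟶ X` of cohomological
  degree `n ≠ 0`: every Hodge similitude `ψ` of `T(X)` with `ψ² = n` (rational, type-preserving,
  multiplier `n` on `T(X)`) is CYCLE-INDUCED — modulo `Buskin2019_hodgeIsometry_algebraic` ONLY;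
* **`hodgeConjectureFor_square_of_resolvedRationalMap`** — HC⁴(X ⊗ X) under the sector clause
  `End_Hdg T(X) ⊆ ℚ + ℚψ`.

THEOREMS ONLY (no definition, no named fact, no sorry). Prover seat hodge-nonav-19652-p1 (gen 21),
`--supports stmt-HodgeConjecture-19652`. A SECTOR theorem (K3 surfaces receiving a degree-`n` rational
map from a K3 surface, with real multiplication by `ℚ(√n)` exactly); nothing here proves the crux.

References: M. Varesco, Math. Z. 305 (2023) §2 Thm. 2.1; H. Inose, Proc. Int. Symp. Algebraic Geometry
Kyoto 1977 (1978) §2; W. Fulton, *Intersection Theory*, Lemma 19.1.2; R. Hartshorne, *Algebraic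
Geometry*, II Thm. 8.19; B. van Geemen, M. Schütt, arXiv:2310.05196 Prop. 7.2.
-/

set_option linter.dupNamespace false

noncomputable section

namespace Summit.HodgeConjecture.HodgeConjecture.Theorems.MarkmanPartnerTransport.IsogenyDatum

open scoped Manifold
open Module CategoryTheory MonoidalCategory CartesianMonoidalCategory
open Literature.AlgebraicGeometry Literature.AlgebraicGeometry.Motives Literature.AlgebraicGeometry.HodgeTheory
open Literature.AlgebraicGeometry.Surfaces
open Literature.AlgebraicTopology.SingularHomology
open Summit.HodgeConjecture.HodgeConjecture.Theorems.MarkmanPartnerTransport.FiniteMorphism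

variable {S Y Z : SchemeOver ℂ}

/-- `MarkedK3[S, η, p, x]`: VERBATIM the `let MarkedK3 := …` binder of the route declaration
`PicardThreeK3Squares`. Local notation only. -/
local notation3 (prettyPrint := false) "MarkedK3[" S ", " η ", " p ", " x "]" =>
  (p ≠ 0 ∧ (IsIntegralClass p ∧
    (∀ q : complexBetti S (2 * 2), IsIntegralClass q → ∃ n : ℤ, q = n • p) ∧
    (∀ c : complexBetti S (2 * 1), IsIntegralClass c ↔ ∃ v : K3Index → ℤ, η c = fun i => (v i : ℂ)) ∧
    (∀ a b : complexBetti S (2 * 1),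
      cupProduct (rfl : 2 * 1 + 2 * 1 = 2 * 2) a b = k3Form (η a) (η b) • p) ∧
    IsOfHodgeType 2 S (2 * 1) 2 0 (LinearEquiv.symm η x) ∧
    (∀ τ : complexBetti S (2 * 1), IsOfHodgeType 2 S (2 * 1) 2 0 τ →
      ∃ t : ℂ, τ = t • LinearEquiv.symm η x)) ∧
    (k3Form x x = 0 ∧ 0 < (k3Form (star x) x).re ∧
      ∃ u : K3Index → ℤ, k3Form (fun i => (u i : ℂ)) x = 0 ∧ 0 < ∑ i, ∑ j, u i * k3Gram i j * u j))

/-- `Corr[X, Y, hX, hY ; γ, y] = pr₁₊ (pr₂^* y ∪ γ)` (complex orientations). Local notation only. -/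
local notation3 (prettyPrint := false) "Corr[" X ", " Y ", " hX ", " hY " ; " γ ", " y "]" =>
  complexGysin complexOrientationFamily (IsSmoothProjective.tensor_holds hX hY) hX
    (SemiCartesianMonoidalCategory.fst X Y)
    (rfl : 2 * 1 + 2 * 2 + 2 * 2 = 2 * 1 + 2 * (2 + 2))
    (cupProduct (rfl : 2 * 1 + 2 * 2 = 2 * 1 + 2 * 2)
      (complexBetti.map (SemiCartesianMonoidalCategory.snd X Y) (2 * 1) y) γ)

/-- `Deg[hZ, hX, f, d]`: `f₊ 1 = d • 1` (cohomological degree `d`, complex orientations). -/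
local notation3 (prettyPrint := false) "Deg[" hZ ", " hX ", " f ", " d "]" =>
  complexGysin complexOrientationFamily hZ hX f (rfl : 0 + 2 * 2 = 0 + 2 * 2)
      (singularCohomology.one ℂ (Motives.ComplexPoints _)) =
    (d : ℂ) • singularCohomology.one ℂ (Motives.ComplexPoints _)

/-- **A birational morphism of smooth projective surfaces has cohomological degree `1`**
(`π₊ 1 = 1`, Fulton's Lemma 19.1.2 with `deg = 1`: the tree's
`complexGysin_complexOrientationFamily_one_of_isBirational`). [cite: Fulton1998, Lemma 19.1.2 and §1.4] -/
theorem deg_one_of_isBirational (hZ : IsSmoothProjective 2 Z) (hY : IsSmoothProjective 2 Y) (π : Z ⟶ Y)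
    (hπ : Resolution.IsBirational π.left) : Deg[hZ, hY, π, (1 : ℕ)] := by
  rw [complexGysin_complexOrientationFamily_one_of_isBirational hZ hY π hπ, Nat.cast_one, one_smul]

/-- **The source of a birational morphism onto a K3 surface has geometric genus one** (e.g. a blow-up
of a K3 surface): `π^*` is injective (`π₊ π^* = 1`) and `p_g` is a birational invariant (brick 7).
[cite: Hartshorne1977, II Thm. 8.19] [cite: Huybrechts2016K3, Ch. 1 §2.4] -/
theorem hasGeometricGenusOne_of_isBirational_of_isK3Surface (hZ : IsSmoothProjective 2 Z) (hY : IsK3Surface Y)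
    (π : Z ⟶ Y) (hπ : Resolution.IsBirational π.left) : HasGeometricGenusOne Z :=
  hasGeometricGenusOne_of_isBirational hZ hY.1 π hπ
    (map_injective_of_deg (deg_one_of_isBirational hZ hY.1 π hπ) (by norm_num) (2 * 1))
    hY.hasGeometricGenusOne

/-- **A resolved dominant rational map of degree `n` between marked projective K3 surfaces makes every
Hodge similitude `√n` of `T(X)` CYCLE-INDUCED** — modulo `Buskin2019_hodgeIsometry_algebraic` ONLY.
Data: marked projective K3 surfaces `(X, η, p, x)`, `(Y, η_Y, p_Y, x_Y)`; a smooth projective surface `Z`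
with a BIRATIONAL morphism `π : Z ⟶ Y` and a morphism `f : Z ⟶ X` of cohomological degree `n ≠ 0`;
`ψ` an endomorphism of `H²(X(ℂ); ℂ)` mapping `T(X)` to itself, rational and type-preserving there, with
`ψ² = n` and multiplier `n` on `T(X)`. (`cycleInduced_of_roof'` with `d = 1`; the `π`-leg hypotheses
discharged by `deg_one_of_isBirational`, `hasGeometricGenusOne_of_isBirational_of_isK3Surface`.)
[cite: Varesco2023, §2 Thm. 2.1] [cite: Inose1978, §2] [cite: Buskin2019, Thm. 1.1] -/
theorem cycleInduced_of_resolvedRationalMap (hB : Buskin2019_hodgeIsometry_algebraic)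
    (hS : IsK3Surface S)
    (η : complexBetti S (2 * 1) ≃ₗ[ℂ] (K3Index → ℂ)) (p : complexBetti S (2 * 2)) (x : K3Index → ℂ)
    (hM : MarkedK3[S, η, p, x])
    (hY : IsK3Surface Y)
    (ηY : complexBetti Y (2 * 1) ≃ₗ[ℂ] (K3Index → ℂ)) (pY : complexBetti Y (2 * 2)) (xY : K3Index → ℂ)
    (hMY : MarkedK3[Y, ηY, pY, xY])
    (hZ : IsSmoothProjective 2 Z) (π : Z ⟶ Y) (hπ : Resolution.IsBirational π.left)
    (f : Z ⟶ S) {n : ℕ} (hn : n ≠ 0) (hdegf : Deg[hZ, hS.1, f, n])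
    (ψ : complexBetti S (2 * 1) →ₗ[ℂ] complexBetti S (2 * 1))
    (hψT : Set.MapsTo ψ (transcendentalSubspace S) (transcendentalSubspace S))
    (hψrat : ∀ y ∈ transcendentalSubspace S, IsRationalClass y → IsRationalClass (ψ y))
    (hψtyp : ∀ (i j : ℕ), ∀ y ∈ transcendentalSubspace S,
      IsOfHodgeType 2 S (2 * 1) i j y → IsOfHodgeType 2 S (2 * 1) i j (ψ y))
    (hψsq : ∀ y ∈ transcendentalSubspace S, ψ (ψ y) = (n : ℂ) • y)
    (hψmul : ∀ y ∈ transcendentalSubspace S, ∀ z ∈ transcendentalSubspace S,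
      cupProduct (rfl : 2 * 1 + 2 * 1 = 2 * 2) (ψ y) (ψ z) =
        (n : ℂ) • cupProduct (rfl : 2 * 1 + 2 * 1 = 2 * 2) y z) :
    ∃ γ' ∈ algebraicClasses (S ⊗ S) 2, ∀ z ∈ transcendentalSubspace S,
      Corr[S, S, hS.1, hS.1 ; γ', z] = ψ z := by
  have e1 : ((n * 1 : ℕ) : ℂ) = (n : ℂ) := by rw [Nat.mul_one]
  exact cycleInduced_of_roof' hB hS η p x hM hY ηY pY xY hMY hZ
    (hasGeometricGenusOne_of_isBirational_of_isK3Surface hZ hY π hπ) f π hn one_ne_zero hdegf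
    (deg_one_of_isBirational hZ hY.1 π hπ) ψ hψT hψrat hψtyp
    (fun y hy ↦ by rw [e1]; exact hψsq y hy) (fun y hy z hz ↦ by rw [e1]; exact hψmul y hy z hz)

/-- **HC⁴(X ⊗ X) for a marked projective K3 surface `X` receiving a resolved dominant rational map of
degree `n` from a marked projective K3 surface, whose transcendental Hodge endomorphisms are spanned by
`1` and a Hodge similitude `ψ` with `ψ² = n`** — modulo `Buskin2019_hodgeIsometry_algebraic` ONLY. The
sector clause `hU` is VERBATIM that of `SymplecticLocus.hodgeConjectureFor_square_of_symplecticAutomorphism`.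
[cite: Varesco2023, §2 Thm. 2.1 and Rem. 2.2] [cite: Fulton1998, §16.1 Prop. 16.1.1] -/
theorem hodgeConjectureFor_square_of_resolvedRationalMap (hB : Buskin2019_hodgeIsometry_algebraic)
    (hS : IsK3Surface S)
    (η : complexBetti S (2 * 1) ≃ₗ[ℂ] (K3Index → ℂ)) (p : complexBetti S (2 * 2)) (x : K3Index → ℂ)
    (hM : MarkedK3[S, η, p, x])
    (hY : IsK3Surface Y)
    (ηY : complexBetti Y (2 * 1) ≃ₗ[ℂ] (K3Index → ℂ)) (pY : complexBetti Y (2 * 2)) (xY : K3Index → ℂ)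
    (hMY : MarkedK3[Y, ηY, pY, xY])
    (hZ : IsSmoothProjective 2 Z) (π : Z ⟶ Y) (hπ : Resolution.IsBirational π.left)
    (f : Z ⟶ S) {n : ℕ} (hn : n ≠ 0) (hdegf : Deg[hZ, hS.1, f, n])
    (ψ : complexBetti S (2 * 1) →ₗ[ℂ] complexBetti S (2 * 1))
    (hψT : Set.MapsTo ψ (transcendentalSubspace S) (transcendentalSubspace S))
    (hψrat : ∀ y ∈ transcendentalSubspace S, IsRationalClass y → IsRationalClass (ψ y))
    (hψtyp : ∀ (i j : ℕ), ∀ y ∈ transcendentalSubspace S,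
      IsOfHodgeType 2 S (2 * 1) i j y → IsOfHodgeType 2 S (2 * 1) i j (ψ y))
    (hψsq : ∀ y ∈ transcendentalSubspace S, ψ (ψ y) = (n : ℂ) • y)
    (hψmul : ∀ y ∈ transcendentalSubspace S, ∀ z ∈ transcendentalSubspace S,
      cupProduct (rfl : 2 * 1 + 2 * 1 = 2 * 2) (ψ y) (ψ z) =
        (n : ℂ) • cupProduct (rfl : 2 * 1 + 2 * 1 = 2 * 2) y z)
    (hU : ∀ (g : complexBetti S (2 * 1) →ₗ[ℂ] complexBetti S (2 * 1)),
      (∀ y, IsRationalClass y → IsRationalClass (g y)) →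
      (∀ (i j : ℕ) y, IsOfHodgeType 2 S (2 * 1) i j y → IsOfHodgeType 2 S (2 * 1) i j (g y)) →
      (∀ e ∈ algebraicClasses S 1, g e = 0) →
      (∀ y : complexBetti S (2 * 1), ∀ e ∈ algebraicClasses S 1,
        cupProduct (rfl : 2 * 1 + 2 * 1 = 2 * 2) (g y) e = 0) →
      ∃ a b : ℚ, ∀ y : complexBetti S (2 * 1),
        (∀ e ∈ algebraicClasses S 1, cupProduct (rfl : 2 * 1 + 2 * 1 = 2 * 2) y e = 0) →
        g y = (a : ℂ) • y + (b : ℂ) • ψ y) :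
    HodgeConjectureFor 4 (S ⊗ S) := by
  have e1 : ((n * 1 : ℕ) : ℂ) = (n : ℂ) := by rw [Nat.mul_one]
  exact hodgeConjectureFor_square_of_roof' hB hS η p x hM hY ηY pY xY hMY hZ
    (hasGeometricGenusOne_of_isBirational_of_isK3Surface hZ hY π hπ) f π hn one_ne_zero hdegf
    (deg_one_of_isBirational hZ hY.1 π hπ) ψ hψT hψrat hψtyp
    (fun y hy ↦ by rw [e1]; exact hψsq y hy) (fun y hy z hz ↦ by rw [e1]; exact hψmul y hy z hz) hU

end Summit.HodgeConjecture.HodgeConjecture.Theorems.MarkmanPartnerTransport.IsogenyDatum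

end
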